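import Mathlib.MeasureTheory.Integral.IntervalIntegral.Periodic
import Mathlib.Order.LiminfLimsup
import Mathlib.Topology.Algebra.Order.Floor
import Literature.Analysis.FluidPDE.TurbWave0
import Literature.Analysis.FluidPDE.ZerothLaw
import HarnessLib

/-!
# Long-time averages of time-periodic functions (`Literature.Turb` API for Wave0 / ZerothLaw)

For a `τ`-periodic real function of time `g` (`τ > 0`) the Cesàro means `T⁻¹ ∫₀ᵀ g` converge, as
`T → ∞`, to the period average `τ⁻¹ ∫₀^τ g` (`tendsto_timeMean_atTop_of_periodic`); consequently the
three long-time averages of `Literature.Analysis.FluidPDE.TurbWave0` — `Turb.longTimeAvgSup`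
(limsup), `Turb.longTimeAvgInf` (liminf) and every generalized (Banach) limit
`GeneralizedLimit.longTimeAvg` — all equal the period average
(`longTimeAvgSup_eq_of_periodic`, `longTimeAvgInf_eq_of_periodic`,
`GeneralizedLimit.longTimeAvg_eq_of_periodic`). *Junk values included:* if `g` is not
integrable on a period then both sides are `0` (`timeMean_eq_zero_of_not_intervalIntegrable`), so
no integrability hypothesis is needed. Specialised to time-periodic velocity fields this computes
the mean energy `⟨‖u‖₂²⟩` and the mean dissipation `⟨ν‖∇u‖₂²⟩` of
`Literature.Analysis.FluidPDE.ZerothLaw` as period averages (`meanEnergy_eq_of_periodic`,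
`meanDissipation_eq_of_periodic`), the bookkeeping step "long-time average = average over one
period" used for time-periodic solutions in Cheskidov (2023), §6 (proof of Thm. 1.3, first display
on p. 19). All proofs are real; nothing is defined. (The route file
`Summits/AnomalousDissipation/…/Theorems/EulerLimitCesaro.lean` proves the special case of a
*continuous* periodic `g` under the name `Literature.Turb.tendsto_timeMean_of_periodic`; Literature cannot
import it, and the versions here need no continuity or integrability.)

## Proof

Mathlib's `Function.Periodic.sInf_add_zsmul_le_integral_of_pos` /
`integral_le_sSup_add_zsmul_of_pos` sandwich `∫₀ᵀ g` between `X + ⌊T/τ⌋ • ∫₀^τ g` for two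
constants `X`; dividing by `T` and using `⌊T/τ⌋ / T → τ⁻¹` (`tendsto_floor_div_mul_inv`) gives the
limit by squeezing.

## References

* A. Cheskidov, *Dissipation anomaly and anomalous dissipation in incompressible fluid flows*,
  arXiv:2311.04182 (2023), §6.
* C. R. Doering, C. Foias, *Energy dissipation in body-forced turbulence*, J. Fluid Mech. 467
  (2002), §2 (the averages `⟨·⟩`).
-/

open MeasureTheory Set Filter Topology

namespace Literature.Analysis.FluidPDE

/-- `⌊T/τ⌋ / T → 1/τ` as `T → +∞` (`τ > 0`): squeeze between `(T/τ - 1)/T = τ⁻¹ - T⁻¹` and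
`(T/τ)/T = τ⁻¹`. [folklore] -/
theorem tendsto_floor_div_mul_inv {τ : ℝ} (hτ : 0 < τ) :
    Tendsto (fun t : ℝ => (⌊t / τ⌋ : ℝ) * t⁻¹) atTop (𝓝 τ⁻¹) := by
  have h1 : Tendsto (fun t : ℝ => τ⁻¹ - t⁻¹) atTop (𝓝 τ⁻¹) := by
    simpa using (tendsto_const_nhds (x := τ⁻¹)).sub tendsto_inv_atTop_zero
  refine tendsto_of_tendsto_of_tendsto_of_le_of_le' h1 tendsto_const_nhds ?_ ?_
  · filter_upwards [eventually_gt_atTop (0 : ℝ)] with t ht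
    have hfl : t / τ - 1 ≤ (⌊t / τ⌋ : ℝ) := by
      have := Int.sub_one_lt_floor (t / τ)
      linarith
    have ht0 : (0 : ℝ) ≤ t⁻¹ := inv_nonneg.mpr ht.le
    calc τ⁻¹ - t⁻¹ = (t / τ - 1) * t⁻¹ := by field_simp
      _ ≤ (⌊t / τ⌋ : ℝ) * t⁻¹ := mul_le_mul_of_nonneg_right hfl ht0
  · filter_upwards [eventually_gt_atTop (0 : ℝ)] with t ht
    have hfl : (⌊t / τ⌋ : ℝ) ≤ t / τ := Int.floor_le _
    have ht0 : (0 : ℝ) ≤ t⁻¹ := inv_nonneg.mpr ht.le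
    calc (⌊t / τ⌋ : ℝ) * t⁻¹ ≤ (t / τ) * t⁻¹ := mul_le_mul_of_nonneg_right hfl ht0
      _ = τ⁻¹ := by field_simp

/-- **Cesàro means of a periodic function.** If `g : ℝ → ℝ` is `τ`-periodic (`τ > 0`) and
integrable on a period, then `T⁻¹ ∫₀ᵀ g → τ⁻¹ ∫₀^τ g` as `T → +∞`. [folklore] -/
theorem tendsto_timeMean_of_periodic_of_intervalIntegrable {g : ℝ → ℝ} {τ : ℝ} (hg : Function.Periodic g τ)
    (hτ : 0 < τ) (h_int : IntervalIntegrable g volume 0 τ) :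
    Tendsto (timeMean g) atTop (𝓝 (τ⁻¹ * ∫ x in (0 : ℝ)..τ, g x)) := by
  set I : ℝ := ∫ x in (0 : ℝ)..τ, g x with hI
  set X₁ : ℝ := sInf ((fun t => ∫ x in (0 : ℝ)..t, g x) '' Icc 0 τ) with hX₁
  set X₂ : ℝ := sSup ((fun t => ∫ x in (0 : ℝ)..t, g x) '' Icc 0 τ) with hX₂
  have hfloor := tendsto_floor_div_mul_inv hτ
  have hlim : ∀ X : ℝ,
      Tendsto (fun t : ℝ => (X + (⌊t / τ⌋ : ℝ) * I) * t⁻¹) atTop (𝓝 (τ⁻¹ * I)) := by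
    intro X
    have h0 : Tendsto (fun t : ℝ => X * t⁻¹) atTop (𝓝 0) := by
      simpa using tendsto_inv_atTop_zero.const_mul X
    have h1 : Tendsto (fun t : ℝ => I * ((⌊t / τ⌋ : ℝ) * t⁻¹)) atTop (𝓝 (I * τ⁻¹)) :=
      hfloor.const_mul I
    have h2 := h0.add h1
    rw [zero_add, mul_comm I] at h2
    refine h2.congr' (Eventually.of_forall fun t => ?_)
    ring
  refine tendsto_of_tendsto_of_tendsto_of_le_of_le' (hlim X₁) (hlim X₂) ?_ ?_
  · filter_upwards [eventually_gt_atTop (0 : ℝ)] with t ht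
    have h := hg.sInf_add_zsmul_le_integral_of_pos h_int hτ t
    rw [zsmul_eq_mul, ← hX₁] at h
    have ht0 : (0 : ℝ) ≤ t⁻¹ := inv_nonneg.mpr ht.le
    calc (X₁ + (⌊t / τ⌋ : ℝ) * I) * t⁻¹ ≤ (∫ x in (0 : ℝ)..t, g x) * t⁻¹ :=
          mul_le_mul_of_nonneg_right h ht0
      _ = timeMean g t := by rw [timeMean, mul_comm]
  · filter_upwards [eventually_gt_atTop (0 : ℝ)] with t ht
    have h := hg.integral_le_sSup_add_zsmul_of_pos h_int hτ t
    rw [zsmul_eq_mul, ← hX₂] at h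
    have ht0 : (0 : ℝ) ≤ t⁻¹ := inv_nonneg.mpr ht.le
    calc timeMean g t = (∫ x in (0 : ℝ)..t, g x) * t⁻¹ := by rw [timeMean, mul_comm]
      _ ≤ (X₂ + (⌊t / τ⌋ : ℝ) * I) * t⁻¹ := mul_le_mul_of_nonneg_right h ht0

/-- Junk case: if `g` is not integrable on `[0, τ]` (`0 ≤ τ ≤ T`), it is not integrable on
`[0, T]` either, so the Cesàro mean `T⁻¹ ∫₀ᵀ g` is the junk value `0`. [folklore] -/
theorem timeMean_eq_zero_of_not_intervalIntegrable {g : ℝ → ℝ} {τ T : ℝ} (hτ : 0 ≤ τ)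
    (hT : τ ≤ T) (h : ¬ IntervalIntegrable g volume 0 τ) : timeMean g T = 0 := by
  unfold timeMean
  rw [intervalIntegral.integral_undef, mul_zero]
  intro hT_int
  refine h (hT_int.mono_set ?_)
  rw [uIcc_of_le hτ, uIcc_of_le (hτ.trans hT)]
  exact Icc_subset_Icc le_rfl hT

/-- **Cesàro means of a periodic function, junk included.** If `g : ℝ → ℝ` is `τ`-periodic
(`τ > 0`), then `T⁻¹ ∫₀ᵀ g → τ⁻¹ ∫₀^τ g` as `T → +∞`, with no integrability hypothesis: when `g`
is not integrable on a period both the means (eventually) and the period average are the junk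
value `0`. [folklore] -/
theorem tendsto_timeMean_atTop_of_periodic {g : ℝ → ℝ} {τ : ℝ} (hg : Function.Periodic g τ)
    (hτ : 0 < τ) : Tendsto (timeMean g) atTop (𝓝 (τ⁻¹ * ∫ x in (0 : ℝ)..τ, g x)) := by
  by_cases h_int : IntervalIntegrable g volume 0 τ
  · exact tendsto_timeMean_of_periodic_of_intervalIntegrable hg hτ h_int
  · rw [intervalIntegral.integral_undef h_int, mul_zero]
    refine (tendsto_const_nhds (x := (0 : ℝ))).congr' ?_
    filter_upwards [eventually_ge_atTop τ] with T hT
    exact (timeMean_eq_zero_of_not_intervalIntegrable hτ.le hT h_int).symm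

/-- **Long-time average of a periodic function (limsup).** For `τ`-periodic `g` (`τ > 0`),
`⟨g⟩⁺ = limsup_{T→∞} T⁻¹ ∫₀ᵀ g = τ⁻¹ ∫₀^τ g` (junk values included). [folklore] -/
theorem longTimeAvgSup_eq_of_periodic {g : ℝ → ℝ} {τ : ℝ} (hg : Function.Periodic g τ)
    (hτ : 0 < τ) : longTimeAvgSup g = τ⁻¹ * ∫ x in (0 : ℝ)..τ, g x :=
  (tendsto_timeMean_atTop_of_periodic hg hτ).limsup_eq

/-- **Long-time average of a periodic function (liminf).** For `τ`-periodic `g` (`τ > 0`),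
`⟨g⟩⁻ = liminf_{T→∞} T⁻¹ ∫₀ᵀ g = τ⁻¹ ∫₀^τ g` (junk values included). [folklore] -/
theorem longTimeAvgInf_eq_of_periodic {g : ℝ → ℝ} {τ : ℝ} (hg : Function.Periodic g τ)
    (hτ : 0 < τ) : longTimeAvgInf g = τ⁻¹ * ∫ x in (0 : ℝ)..τ, g x :=
  (tendsto_timeMean_atTop_of_periodic hg hτ).liminf_eq

/-- **Long-time average of a periodic function (generalized limits).** Every generalized
(Banach) limit at `+∞` assigns to the Cesàro means of a `τ`-periodic `g` (`τ > 0`) the period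
average `τ⁻¹ ∫₀^τ g` (Doering–Foias 2002, §2: `Lim` extends the ordinary limit). [cite: DoeringFoias2002, §2] -/
theorem GeneralizedLimit.longTimeAvg_eq_of_periodic (Λ : GeneralizedLimit) {g : ℝ → ℝ} {τ : ℝ}
    (hg : Function.Periodic g τ) (hτ : 0 < τ) :
    Λ.longTimeAvg g = τ⁻¹ * ∫ x in (0 : ℝ)..τ, g x :=
  Λ.longTimeAvg_eq_of_tendsto (tendsto_timeMean_atTop_of_periodic hg hτ)

/-- For `τ`-periodic `g` (`τ > 0`) the `limsup` and `liminf` long-time averages agree. [folklore] -/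
theorem longTimeAvgSup_eq_longTimeAvgInf_of_periodic {g : ℝ → ℝ} {τ : ℝ}
    (hg : Function.Periodic g τ) (hτ : 0 < τ) : longTimeAvgSup g = longTimeAvgInf g := by
  rw [longTimeAvgSup_eq_of_periodic hg hτ, longTimeAvgInf_eq_of_periodic hg hτ]

variable {d : Type*} [Fintype d]

/-- **Mean energy of a time-periodic field** (Cheskidov 2023, §6: long-time averages of the
`τ`-periodic solutions of Thm. 1.3 are averages over one period). If `u (t + τ) = u t` for all
`t` (`τ > 0`), then `⟨‖u‖₂²⟩ = τ⁻¹ ∫₀^τ ‖u(t)‖₂² dt` (junk values included). [cite: Cheskidov2023, §6] -/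
theorem meanEnergy_eq_of_periodic {u : ℝ → UnitAddTorus d → EuclideanSpace ℝ d} {τ : ℝ}
    (hu : Function.Periodic u τ) (hτ : 0 < τ) :
    meanEnergy u = τ⁻¹ * ∫ t in (0 : ℝ)..τ, ∫ x, ‖u t x‖ ^ 2 := by
  have hper : Function.Periodic (fun t => ∫ x, ‖u t x‖ ^ 2) τ := fun t => by
    simp only [hu t]
  exact longTimeAvgSup_eq_of_periodic hper hτ

/-- **Mean dissipation of a time-periodic field** (Cheskidov 2023, §6, first display on p. 19:
`lim_{T→∞} T⁻¹ ∫₀ᵀ ν‖∇u‖₂² = τ⁻¹ ∫_{period} ν‖∇u‖₂²` for the `τ`-periodic solutions of Thm. 1.3).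
If `u (t + τ) = u t` for all `t` (`τ > 0`), then
`⟨ν‖∇u‖₂²⟩ = τ⁻¹ ∫₀^τ ν‖∇u(t)‖₂² dt` with the spectral gradient norm of `Turb.meanDissipation`
(junk values included). [cite: Cheskidov2023, §6] -/
theorem meanDissipation_eq_of_periodic {ν : ℝ} {u : ℝ → UnitAddTorus d → EuclideanSpace ℝ d}
    {τ : ℝ} (hu : Function.Periodic u τ) (hτ : 0 < τ) :
    meanDissipation ν u = τ⁻¹ * ∫ t in (0 : ℝ)..τ, ν * (FunctionSpaces.Torus.eGradNormSq (u t)).toReal := by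
  have hper : Function.Periodic (fun t => ν * (FunctionSpaces.Torus.eGradNormSq (u t)).toReal) τ := fun t => by
    simp only [hu t]
  exact longTimeAvgSup_eq_of_periodic hper hτ

/-- **R.m.s. velocity of a time-periodic field**: `U = √(τ⁻¹ ∫₀^τ ‖u(t)‖₂² dt)` for
`τ`-periodic `u` (`τ > 0`) (Cheskidov 2023, §6, normalisation of the amplitudes `a_m`). [cite: Cheskidov2023, §6] -/
theorem rmsVelocity_eq_of_periodic {u : ℝ → UnitAddTorus d → EuclideanSpace ℝ d} {τ : ℝ}
    (hu : Function.Periodic u τ) (hτ : 0 < τ) :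
    rmsVelocity longTimeAvgSup u = Real.sqrt (τ⁻¹ * ∫ t in (0 : ℝ)..τ, ∫ x, ‖u t x‖ ^ 2) := by
  rw [rmsVelocity_eq_sqrt_meanEnergy, meanEnergy_eq_of_periodic hu hτ]

end Literature.Analysis.FluidPDE
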